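import Summits.HubbardSuperconductivity.HubbardSuperconductivity.Theses.ThermalWedge
import Summits.HubbardSuperconductivity.HubbardSuperconductivity.Theorems.ThermalWedgeTwExponentialCeilingOfFermiLiquidLaws
import Summits.HubbardSuperconductivity.HubbardSuperconductivity.Theorems.ThermalWedgeTwSourcedInertnessThermalCorrectionEntropy
import Literature.MathematicalPhysics.QuantumLattice.AngularSectors
import Literature.MathematicalPhysics.QuantumLattice.HubbardFermiCurve
import Summits.HubbardSuperconductivity.HubbardSuperconductivity.Theorems.ThermalWedgeTwSourcedInertnessFourSectorCount

/-!
# Crux `TwSourcedInertness` (item `stmt-HubbardSuperconductivity-1696`), line `umklapp-is-a-fold`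
(≈ `torus-sector-counting`, merged by triage) — the SECOND lead's skeleton (prover-line-…-1696-c1-0),
rebuilt from the registered signatures (the planners' `Lines/` files are not mounted in this jail).

IDEA. Benfatto–Giuliani–Mastropietro's convergent multiscale expansion for the weakly repulsive 2D
Hubbard model at `T ≥ e^{-a/U}` is in print only for `μ ∈ (−4, −2−√2)` because there momentum
conservation admits no umklapp at vertices with `≤ 8` legs; at every filling `μ ∈ (−4, 0)` the
geometry of the Fermi curve `{ε = μ}` survives (`HubbardFermiRadiusBand*`, `HubbardFermiBandCurvature`,
`HubbardUmklappKinematics`, `HubbardUmklappFold`: strict convexity, bi-Lipschitz Gauss map, umklapp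
quadruples are Cooper-disjoint and degenerate only at folds), so the missing input is the SECTOR
COUNTING modulo `2πℤ²` (`stub_fourSectorCount`, the single-scale isotropic 4-sector count, all
reciprocal targets `G` — PROVED, p108686), after which the engine (stubs `stub_discSusceptibility_of_counting`,
`stub_entropyDensity_of_counting`) delivers the two interacting Fermi-liquid laws Sχ (KMB `d`-wave pair
susceptibility `≤ C(1+log β)` on the thermal disc) and SS (entropy density `≤ C(1+log β)/β`), which
close the crux by the tree's `twSourcedInertness_of_discSusceptibility_of_thermalCorrection` and
`stub_thermalCorrection_of_entropyDensityLaw`.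

RESHAPE vs the umklapp planner's registration (skeleton 8fe469b3): the two-scale stub
`stub_modularSectorCounting` (count `≤ K^{l+4}·2^{(n'−n)(l+1)}`) is DROPPED — it is false at `l = 0`,
`G = (1,0)`, `μ ∈ (−2,0)` (umklapp triple point `k₁=k₂=k₃=p*`, `k₀ = 2πG − 3p*`: `≥ c·4^{n'−n}` fine
triples for `n' ≤ 2n`; see PICKED-c1.md) — and `stub_umklappFold` is now the Literature theorem
`fermiPolar_eq_of_umklapp_of_cross_eq_zero`; the engine stubs are keyed on H1 alone.

REGISTRY. The first lead (`prover-line-…-1696-1`, line `temperature-for-source-exchange`, skeleton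
86a61e78) works `stub_discCorrection` / `stub_thermalCorrection`; they are carried here BYTE-IDENTICAL
(second composition `TwSourcedInertness_of'`) only so that registering this skeleton does not expire
their records. No worker of this line touches them.
-/

set_option linter.dupNamespace false

noncomputable section

open Classical

namespace Summit.HubbardSuperconductivity.HubbardSuperconductivity.Theorems

open Matrix Finset Literature.MathematicalPhysics.QuantumLattice Literature.Probability.LatticeModels
open Summit.HubbardSuperconductivity.HubbardSuperconductivity.Theses.ThermalWedge

/-! ## Geometric layer -/

/-! `stub_fourSectorCount` (H1) is now the tree theorem
`Summit.HubbardSuperconductivity.HubbardSuperconductivity.Theorems.stub_fourSectorCount`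
(Theorems/ThermalWedgeTwSourcedInertnessFourSectorCount.lean, p108686, wave 1 of this line; toolbox
Literature/MathematicalPhysics/QuantumLattice/HubbardBandSectorCounting{Bounds,Toolbox,Counts}.lean,
p104905/p107615/p108063) — imported above, the sorry is gone. -/

/-! ## Engine layer (XL: the multiscale expansion at general filling, given the counting) -/

/-- Stub `stub_discSusceptibility_of_counting` (XL, the lead's): GIVEN the four-sector count H1, the
Kubo–Mori–Bogoliubov `d`-wave pair susceptibility of the sourced torus Gibbs state is `≤ C(1+log β)`
throughout the thermal disc `|t| ≤ 1/β`, for `0 < U ≤ U₀`, `1 ≤ β ≤ e^{a/U}`, `μ ∈ [μ₁,μ₂]`,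
eventually in `L` (law Sχ = hypothesis `hχ` of `twSourcedInertness_of_discSusceptibility_of_thermalCorrection`).
[cite: BenfattoGiulianiMastropietro2006, Thm 1.1, Thm 2.1 and Remark 2 (the regime; the statement is
the unwritten response-function extension at general filling)] -/
theorem stub_discSusceptibility_of_counting :
    (∀ μ₁ μ₂ : ℝ, -4 < μ₁ → μ₁ ≤ μ₂ → μ₂ < 0 → ∃ K : ℝ, 0 < K ∧ ∀ μ ∈ Set.Icc μ₁ μ₂, ∀ (n : ℕ) (G : Fin 2 → ℤ) (ω₁ : Fin (Literature.MathematicalPhysics.QuantumLattice.sectorCount n)), (((Finset.univ : Finset (Fin (Literature.MathematicalPhysics.QuantumLattice.sectorCount n) × Fin (Literature.MathematicalPhysics.QuantumLattice.sectorCount n) × Fin (Literature.MathematicalPhysics.QuantumLattice.sectorCount n))).filter (fun ω => ∃ k : Fin 4 → Fin 2 → ℝ, (∀ j i, |k j i| < Real.pi) ∧ (∀ j, |Literature.MathematicalPhysics.QuantumLattice.sqDispersion (k j) - μ| ≤ Literature.MathematicalPhysics.QuantumLattice.sectorWidth n) ∧ Literature.MathematicalPhysics.QuantumLattice.sectorIndex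 n (Complex.arg (⟨k 0 0, k 0 1⟩ : ℂ)) = (ω₁ : ℕ) ∧ Literature.MathematicalPhysics.QuantumLattice.sectorIndex n (Complex.arg (⟨k 1 0, k 1 1⟩ : ℂ)) = (ω.1 : ℕ) ∧ Literature.MathematicalPhysics.QuantumLattice.sectorIndex n (Complex.arg (⟨k 2 0, k 2 1⟩ : ℂ)) = (ω.2.1 : ℕ) ∧ Literature.MathematicalPhysics.QuantumLattice.sectorIndex n (Complex.arg (⟨k 3 0, k 3 1⟩ : ℂ)) = (ω.2.2 : ℕ) ∧ (∀ i, ∑ j, k j i = 2 * Real.pi * (G i : ℝ)))).card : ℝ) ≤ K * 2 ^ n * ((n : ℝ) + 1)) →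
    (∀ μ₁ μ₂ : ℝ, -4 < μ₁ → μ₁ ≤ μ₂ → μ₂ < 0 → ∃ U₀ a C : ℝ, 0 < U₀ ∧ 0 < a ∧ 0 < C ∧ ∀ U : ℝ, 0 < U → U ≤ U₀ → ∀ β : ℝ, 1 ≤ β → β ≤ Real.exp (a / U) → ∀ μ ∈ Set.Icc μ₁ μ₂, ∃ L₀ : ℕ, ∀ (L : ℕ) [NeZero L], L₀ ≤ L → ∀ t : ℝ, |t| ≤ 1 / β → β / (L : ℝ) ^ 2 * ((Matrix.duhamel β (Literature.MathematicalPhysics.QuantumLattice.dWaveSourceTorus L U μ t) (Literature.MathematicalPhysics.QuantumLattice.pairField Literature.MathematicalPhysics.QuantumLattice.dWaveFormFactor L + (Literature.MathematicalPhysics.QuantumLattice.pairField Literature.MathematicalPhysics.QuantumLattice.dWaveFormFactor L)ᴴ) (Literature.MathematicalPhysics.QuantumLattice.pairField Literature.MathematicalPhysics.QuantumLattice.dWaveFormFactor L + (Literature.MathematicalPhysics.QuantumLattice.pairField Literature.MathematicalPhysics.QuantumLattice.dWaveFormFactor L)ᴴ)).re - (Matrix.gibbsState β (Literature.MathematicalPhysics.QuantumLattice.dWaveSourceTorus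 L U μ t) (Literature.MathematicalPhysics.QuantumLattice.pairField Literature.MathematicalPhysics.QuantumLattice.dWaveFormFactor L + (Literature.MathematicalPhysics.QuantumLattice.pairField Literature.MathematicalPhysics.QuantumLattice.dWaveFormFactor L)ᴴ)).re ^ 2) ≤ C * (1 + Real.log β)) := by
  sorry

/-- Stub `stub_entropyDensity_of_counting` (XL): GIVEN the four-sector count H1, the von Neumann
entropy of the torus Gibbs state of `hubbardTorusWith 2 L 1 U μ` is `≤ C(1+log β)L²/β` for
`0 < U ≤ U₀`, `1 ≤ β ≤ e^{a/U}`, `μ ∈ [μ₁,μ₂]`, eventually in `L` (law SS = hypothesis of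
`stub_thermalCorrection_of_entropyDensityLaw`). [cite: BenfattoGiulianiMastropietro2006, Thm 1.1 and
Remark 2 (regime; statement = the unwritten free-energy extension at general filling)] -/
theorem stub_entropyDensity_of_counting :
    (∀ μ₁ μ₂ : ℝ, -4 < μ₁ → μ₁ ≤ μ₂ → μ₂ < 0 → ∃ K : ℝ, 0 < K ∧ ∀ μ ∈ Set.Icc μ₁ μ₂, ∀ (n : ℕ) (G : Fin 2 → ℤ) (ω₁ : Fin (Literature.MathematicalPhysics.QuantumLattice.sectorCount n)), (((Finset.univ : Finset (Fin (Literature.MathematicalPhysics.QuantumLattice.sectorCount n) × Fin (Literature.MathematicalPhysics.QuantumLattice.sectorCount n) × Fin (Literature.MathematicalPhysics.QuantumLattice.sectorCount n))).filter (fun ω => ∃ k : Fin 4 → Fin 2 → ℝ, (∀ j i, |k j i| < Real.pi) ∧ (∀ j, |Literature.MathematicalPhysics.QuantumLattice.sqDispersion (k j) - μ| ≤ Literature.MathematicalPhysics.QuantumLattice.sectorWidth n) ∧ Literature.MathematicalPhysics.QuantumLattice.sectorIndex n (Complex.arg (⟨k 0 0, k 0 1⟩ : ℂ)) = (ω₁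 : ℕ) ∧ Literature.MathematicalPhysics.QuantumLattice.sectorIndex n (Complex.arg (⟨k 1 0, k 1 1⟩ : ℂ)) = (ω.1 : ℕ) ∧ Literature.MathematicalPhysics.QuantumLattice.sectorIndex n (Complex.arg (⟨k 2 0, k 2 1⟩ : ℂ)) = (ω.2.1 : ℕ) ∧ Literature.MathematicalPhysics.QuantumLattice.sectorIndex n (Complex.arg (⟨k 3 0, k 3 1⟩ : ℂ)) = (ω.2.2 : ℕ) ∧ (∀ i, ∑ j, k j i = 2 * Real.pi * (G i : ℝ)))).card : ℝ) ≤ K * 2 ^ n * ((n : ℝ) + 1)) →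
    (∀ μ₁ μ₂ : ℝ, -4 < μ₁ → μ₁ ≤ μ₂ → μ₂ < 0 → ∃ U₀ a C : ℝ, 0 < U₀ ∧ 0 < a ∧ 0 < C ∧ ∀ U : ℝ, 0 < U → U ≤ U₀ → ∀ β : ℝ, 1 ≤ β → β ≤ Real.exp (a / U) → ∀ μ ∈ Set.Icc μ₁ μ₂, ∃ L₀ : ℕ, ∀ (L : ℕ) [NeZero L], L₀ ≤ L → Matrix.gibbsEntropy β (Literature.MathematicalPhysics.QuantumLattice.hubbardTorusWith 2 L 1 U μ) ≤ C * (1 + Real.log β) * (L : ℝ) ^ 2 / β) := by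
  sorry

/-! ## The first lead's stubs (line `temperature-for-source-exchange`, skeleton 86a61e78) — carried
verbatim for the shared registry; NOT worked by this line -/

/-- Registered stub `stub_discCorrection` of the first lead (skeleton 86a61e78), verbatim.
[cite: BenfattoGiulianiMastropietro2006, Thm 1.1 and Remark 2] -/
theorem stub_discCorrection :
    ∀ μ₁ μ₂ : ℝ, -4 < μ₁ → μ₁ ≤ μ₂ → μ₂ < 0 → ∃ U₀ a C c : ℝ, 0 < U₀ ∧ 0 < a ∧ 0 < C ∧ 0 < c ∧ ∀ U : ℝ, 0 < U → U ≤ U₀ → ∀ β : ℝ, 1 ≤ β → β ≤ Real.exp (a / U) → ∀ μ ∈ Set.Icc μ₁ μ₂, ∃ L₀ : ℕ, ∀ (L : ℕ) [NeZero L], L₀ ≤ L → ∀ h : ℝ, |h| ≤ c / β → (Real.log (Matrix.partitionFn β (Literature.MathematicalPhysics.QuantumLattice.dWaveSourceTorus L U μ h)).re / (β * (L : ℝ) ^ 2) - Real.log (Matrix.partitionFn β (Literature.MathematicalPhysics.QuantumLattice.dWaveSourceTorus L 0 μ h)).re / (β * (L : ℝ) ^ 2)) - (Real.log (Matrix.partitionFn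 β (Literature.MathematicalPhysics.QuantumLattice.dWaveSourceTorus L U μ 0)).re / (β * (L : ℝ) ^ 2) - Real.log (Matrix.partitionFn β (Literature.MathematicalPhysics.QuantumLattice.dWaveSourceTorus L 0 μ 0)).re / (β * (L : ℝ) ^ 2)) ≤ C * (1 + Real.log β) * h ^ 2 := by
  sorry

/-- Registered stub `stub_thermalCorrection` of the first lead (skeleton 86a61e78), verbatim.
[cite: BenfattoGiulianiMastropietro2006, Thm 1.1 and Remark 2] -/
theorem stub_thermalCorrection :
    ∀ μ₁ μ₂ : ℝ, -4 < μ₁ → μ₁ ≤ μ₂ → μ₂ < 0 → ∃ U₀ a C : ℝ, 0 < U₀ ∧ 0 < a ∧ 0 < C ∧ ∀ U : ℝ, 0 < U → U ≤ U₀ → ∀ β : ℝ, 2 ≤ β → β ≤ Real.exp (a / U) → ∀ μ ∈ Set.Icc μ₁ μ₂, ∃ L₀ : ℕ, ∀ (L : ℕ) [NeZero L], L₀ ≤ L → (Real.log (Matrix.partitionFn (β / 2) (Literature.MathematicalPhysics.QuantumLattice.hubbardTorusWith 2 L 1 U μ)).re / (β / 2 * (L : ℝ) ^ 2) - Real.log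 (Matrix.partitionFn β (Literature.MathematicalPhysics.QuantumLattice.hubbardTorusWith 2 L 1 U μ)).re / (β * (L : ℝ) ^ 2)) - (Real.log (Matrix.partitionFn (β / 2) (Literature.MathematicalPhysics.QuantumLattice.hubbardTorusWith 2 L 1 0 μ)).re / (β / 2 * (L : ℝ) ^ 2) - Real.log (Matrix.partitionFn β (Literature.MathematicalPhysics.QuantumLattice.hubbardTorusWith 2 L 1 0 μ)).re / (β * (L : ℝ) ^ 2)) ≤ C * (1 + Real.log β) / β ^ 2 := by
  sorry

/-! ## Compositions -/

/-- **The crux, modulo the stubs of line `umklapp-is-a-fold`**: H1 feeds the two engine stubs, whose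
outputs Sχ and SS close `TwSourcedInertness` through the tree's bridges
(`twSourcedInertness_of_discSusceptibility_of_thermalCorrection`, `stub_thermalCorrection_of_entropyDensityLaw`). -/
theorem TwSourcedInertness_of : TwSourcedInertness :=
  twSourcedInertness_of_discSusceptibility_of_thermalCorrection
    (stub_discSusceptibility_of_counting stub_fourSectorCount)
    (stub_thermalCorrection_of_entropyDensityLaw (stub_entropyDensity_of_counting stub_fourSectorCount))

/-- The crux modulo the first lead's two stubs (composition `twSourcedInertness_of_corrections`,
landed p84477) — recorded so that both leads' stubs live in one registered skeleton. -/
theorem TwSourcedInertness_of' : TwSourcedInertness :=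
  twSourcedInertness_of_corrections stub_discCorrection stub_thermalCorrection

end Summit.HubbardSuperconductivity.HubbardSuperconductivity.Theorems
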